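import Literature.NumberTheory.EllipticCurves.BurungaleKobayashiNakamuraOta2026.AnticyclotomicEllipticUnitClass
import Literature.NumberTheory.EllipticCurves.ComplexMultiplicationDeuringGrossencharacter
import Literature.NumberTheory.EllipticCurves.BSDSelmerParityDokchitserHeegnerFieldProofs
import Literature.NumberTheory.EllipticCurves.Selmer
import Literature.NumberTheory.EllipticCurves.MordellWeil
import Mathlib.NumberTheory.LegendreSymbol.QuadraticReciprocity
import Mathlib.Order.Filter.AtTopBot.Basic
import HarnessLib

/-!
# Burungale–Kobayashi–Nakamura–Ota 2026 (arXiv:2608.06879v1, PREPRINT), §1.1 (1.1)–(1.2), Lemma 4.4 (2)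
# and §6 (Thm. 6.6, Thm. 6.7): EQUIDISTRIBUTION OF ROOT NUMBERS and the SYSTEMATIC GROWTH OF
# MORDELL–WEIL / SELMER RANKS of a CM elliptic curve over `ℚ` along the anticyclotomic `ℤ_p`-tower at
# a prime `p` RAMIFIED in the CM field — typed STATEMENTS (claim binders, preprint) + proved corollaries

Topic `NumberTheory/EllipticCurves`, sub-directory `BurungaleKobayashiNakamuraOta2026` (namespace =
path). Cross-ladder literature-typing layer (cell `bsd-littype`, seat 10, generation 3). Companion of
`SignedSelmerMainIdentity.lean` (Thm. 1.7 as typed objects), `SignedMainIdentityReductionProofs.lean`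
((5.3)–(5.4) in the kernel), `AnticyclotomicEllipticUnitClass.lean` (the class `z^{ac}` and the
character vocabulary `IsAcCharacter`), `AnticyclotomicStrictSelmerTorsionOPEN.lean`. The source is an
UNREFEREED PREPRINT (v1, 7 Aug 2026): every statement below that is the paper's is a bare
`def …_OPEN : Prop` binder (`[claim …, status: under-review]`, D-0012); nothing of it is asserted.

## Why this file (what was left untyped, and why it is typable)

The module docstring of `SignedSelmerMainIdentity.lean` lists "Thm. 6.7 (rank growth (1.2))" among the
NOT-typed items, next to the statements living on the rank-two local Iwasawa cohomology. But (1.2) and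
Thm. 6.6 ("In particular") / Thm. 6.7 are statements about MORDELL–WEIL RANKS and `p^∞`-SELMER CORANKS
of `E` over the finite layers `K^{ac}_n` of the anticyclotomic `ℤ_p`-extension — and all of that is tree
vocabulary: `ZpExtension K p` with `ZpExtension.IsAnticyclotomic` and the layer fields
`ZpExtension.layer κ n` (`ZpExtension.lean`; the layers are number fields,
`ZpExtension.numberField_layer`), `WeierstrassCurve.mordellWeilRank` (`MordellWeil.lean`),
`WeierstrassCurve.selmerCorank` / `shaCorank` (`Selmer.lean`), the CM frame "`E/ℚ` with CM by `𝒪_K`,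
`K` its CM field" = `W.j ∈ maximalCMJInvariants ∧ IsCMFieldOfJ K W.j` with `d_K = cmFieldDiscr W.j`
(`ComplexMultiplication*.lean`, the frame of `Deuring_exists_heckeCharacter_of_maximalCM`), and for
(1.1) the idelic Hecke characters with root numbers in the weight-two normalisation
(`IsCentralRootNumber`, `IsHeckeConjEquivariant`, `RohrlichAnticyclotomicNonvanishing.lean`) and the
finite-order characters of `Γ^{ac}` of level `≤ n` (`IsAcCharacter`, this directory). So these three
displayed results of the paper are typed here, for `E/ℚ`, hypotheses explicit, AS PRINTED up to the
dictionary recorded decl by decl.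

## The printed statements (arXiv:2608.06879v1; held text `paper:arxiv-2608.06879`: pp. 1–8 = files
## p0001–p0008; from §2 on the file number runs ahead of the printed page: printed p. 26 = p0048,
## p. 36 = p0058, p. 38 = p0060, p. 39 = p0061)

* §1.1 (p. 3): "Let `E/ℚ` be an elliptic curve with CM by the ring of integers `𝒪_K` of an imaginary
  quadratic field `K`, let `p` be an odd prime ramified in `K`, and let `K^{ac}_∞` be the anticyclotomic
  `ℤ_p`-extension of `K` with `n`-th layer `K^{ac}_n`. The global `ε`-constants satisfy
  (1.1) `ε(φχ^a) = (a/p) ε(φχ)`, where `φ` is the Hecke character over `K` associated to `E`, `χ` an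
  anticyclotomic character of order `p^n > 1` and `a` an integer prime to `p`: the root numbers
  equidistribute within every layer of the anticyclotomic tower. Accordingly the Mordell–Weil ranks
  grow systematically — for `n ≫ 0`, (1.2) `rank_{𝒪_K} E(K^{ac}_n) = (p^n − 1)/2 + c` for a constant `c`
  (cf. Theorem 6.7)".
* Lemma 4.4 (p. 26; `Γ := Gal(K^{ac}_∞/K)`, Def. 4.2 "Denote by `Ξ` the set of finite order characters
  of `Γ` and by `Ξ_n` the subset of `Ξ` consisting of characters of order `p^n`"): "2) For `b ∈ ℤ_p^×`
  and a nontrivial finite order character `χ` of `Γ`, we have `ε(φχ^b) = (b/p) ε(φχ)`. 3) For each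
  `k ≥ 0` and each sign `±`, there exist infinitely many finite order characters `χ` of `Γ` with
  `ε(φ φ^k_{ac} η^{−k}_{ac} χ) = ±1`." (Proof: "one may proceed as in the proof of [5, Prop. 8.2]" —
  [5] = the authors' prequel arXiv:2508.17776, also a preprint.) Def. 1.1 (p. 4): "Note that
  `|Ξ^+_{φ,n}| = |Ξ^−_{φ,n}|` by (1.1)."
* §6.2 (p. 36): "In this subsection we assume that `p` is ramified in `K`." **Theorem 6.6** (p. 38):
  "For `n ≥ 1`, we have `corank_𝒪(Sel(K^{ac}_n, W)) = rank_𝒪(Λ_{ac}/ιω^{−ε}_n) +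
  rank_𝒪(X^{ε}_{Λac-tor}/ιω^{−ε}_n) + rank_𝒪(X^{−ε}/ιω^{ε}_n)`, where `X^ε_{Λac-tor}` denotes the
  `Λ_{ac}`-torsion part of `X^ε`. In particular, there exists an integer `c ≥ 0` such that for `n ≫ 1`
  we have `corank_𝒪(Sel(K^{ac}_n, W)) = (p^n − 1)/2 + c`." (Proof: Thm. 5.5, Cor. 6.3 [⇐ Thm. 6.1, under
  Assumption 3.1 (1)], Lemma 6.5; "the degree of `ω^{ε_p(Ind φ)}_n` equals `1 + (p^n−1)/2` and that of
  `ω^{−ε_p(Ind φ)}_n` equals `(p^n−1)/2`".)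
* §6.3 / **Theorem 6.7** (pp. 38–39): "`A_φ` a CM abelian variety over `K` associated to `φ` of
  dimension `[K_φ : ℚ]/2` … **Theorem 6.7.** There exists a constant `c ∈ ℤ` such that for any
  sufficiently large integer `n`, we have `dim_{K_φ}(A_φ(K^{ac}_n) ⊗_ℤ ℚ) = (p^n − 1)/2 + c`." (Proof:
  Weil restriction `A(K^{ac}_n) ⊗ ℚ ≅ ⊕_{χ : ord χ = p^n} (A_{φχ}(K) ⊗ ℚ) ⊕ A(K^{ac}_{n−1}) ⊗ ℚ`; "By
  Rohrlich [28] and Lemma 4.4, for sufficiently large `n` and for a character `χ` … of order `p^n`,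
  putting `ε_χ := ε(φχ)`, we have `ord_{s=1} L(φχ, s) = (1 − ε_χ)/2`, `ord_{s=1} L(φχ^b, s) = (1 + ε_χ)/2`";
  Prop. 6.8 = Gross–Zagier–Kolyvagin for `A_{φχ}`, "[7, Prop. 3.5]".)

## Transcription on the tree's objects (special case of print: `E/ℚ`; the dictionary)

* "`E/ℚ` with CM by `𝒪_K`, `K` the CM field": `W : WeierstrassCurve ℚ`, elliptic,
  `W.j ∈ maximalCMJInvariants`, `IsCMFieldOfJ K W.j` (so `K ≅ ℚ(√d_K)`, `d_K = cmFieldDiscr W.j`).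
  "`p` odd, ramified in `K`": `p ≠ 2`, `(p : ℤ) ∣ cmFieldDiscr W.j` (`p ∣ d_K`). "`K^{ac}_n`": the layer
  `κ.layer n` of ANY `κ : ZpExtension K p` with `κ.IsAnticyclotomic` (the anticyclotomic `ℤ_p`-extension
  of an imaginary quadratic field is unique; `κ` is unique up to `ℤ_p^×` and `layer` is twist-invariant,
  `ZpExtension.layer_unitTwist`). "`n ≫ 0`" / "sufficiently large `n`": `∀ᶠ n in Filter.atTop`.
* (1.2) / Thm. 6.7 for `A_φ = E_K` (`K_φ = K`, since the Hecke character of a CM curve over `ℚ` with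
  `h_K = 1` takes values in `K`): `dim_K(E(K^{ac}_n) ⊗_ℤ ℚ)` for the `K = End_K(E) ⊗ ℚ`-structure is
  `rank_{𝒪_K} E(K^{ac}_n) = ½ rank_ℤ E(K^{ac}_n)`; the tree has no `End`-module structure on points, so
  the statement is typed in the `ℤ`-RANK currency, doubled: `rank_ℤ E(K^{ac}_n) = p^n − 1 + 2c`, `c ∈ ℤ`
  (`(W.baseChange (κ.layer n)).mordellWeilRank`, cast to `ℤ`). This is (1.2) multiplied by `2`, nothing
  more.
* Thm. 6.6 for `E`: `W = W(E)` "the associated divisible module (see §3)" (§1.2.4) is `T^{⊗−1}(1) ⊗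
  ℚ_p/ℤ_p` with `T|_{G_K} ≅ T_pE ⊗_{𝒪_K ⊗ ℤ_p} 𝒪` (§3.2.1), i.e. `E[p^∞] ⊗_{𝒪_𝔭} 𝒪` as a Galois module
  (`T^{⊗−1}(1) ≅ T_pE`, cell dossier LIT-DOSSIER §14.2 (c), quoted in `AnticyclotomicEllipticUnitClass`);
  `Sel = Sel_f` is the Bloch–Kato Selmer group (§3.1.2), which for an abelian variety is the classical
  `p^∞`-Selmer group (Bloch–Kato, Ex. 3.11: `H¹_f =` the Kummer image; at `v ∤ p` both conditions are `0`
  by (3.3)); and `corank_𝒪 = ½ · corank_{ℤ_p}` on `𝒪_𝔭`-modules (`[𝒪_𝔭 : ℤ_p] = 2`; a larger `𝒪` scales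
  both sides). So the typed form is `corank_{ℤ_p} Sel_{p^∞}(E/K^{ac}_n) = p^n − 1 + 2c`, `c ∈ ℕ` — the
  printed display multiplied by `2` — in the tree's `WeierstrassCurve.selmerCorank`. SCOPE: typed for
  `p ≥ 5` only (the intro's standing `p ≥ 5`; at `p = 3`, `K = ℚ(√−3)` Thm. 6.6 rests on Cor. 6.3 ⇐
  Thm. 6.1, which assumes Assumption 3.1 (1), an `H⁰`-vanishing that may fail — Remark 6.2); Thm. 6.7
  and (1.1)–(1.2) are printed for every odd ramified `p` and typed so.
* (1.1) / Lemma 4.4 (2): `φ` = the Hecke character of `E` over `K`, entered through the printed clauses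
  of Deuring's theorem that pin it (`Deuring_exists_heckeCharacter_of_maximalCM`: infinity type `(1,0)`,
  conj-equivariant, `L(E/ℚ, s) = L(s, φ)`); "`χ` a nontrivial finite order character of `Γ`" =
  `IsAcCharacter ι κ n χ r` (this directory: finite order, with `p`-adic avatar `r` factoring through
  `Γ^{ac} = Γ_K/ker κ` and through `Gal(K^{ac}_n/K)`) with `χ ≠ 1`; "`b ∈ ℤ_p^×`" = `a : ℕ` with `p ∤ a`
  (only `b mod p^n` matters); "`ε(φχ)`" = the sign `w` of the functional equation in the tree's
  weight-two normalisation, `IsCentralRootNumber (φ * χ) w` (the reading used in the proof of Thm. 6.7: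
  "`ord_{s=1} L(φχ, s) = (1 − ε_χ)/2`" via Rohrlich, i.e. `ε_χ` IS the root number of
  `RohrlichDichotomy`); `(a/p)` = Mathlib's `legendreSym p a`. Typed as an implication between the two
  root-number predicates (the root number being unique when it exists, this is the printed equality;
  the existence for `φχ^a` — Hecke — rides along).

## What is here

* `eqn11_rootNumber_pow_OPEN` — (1.1) = Lemma 4.4 (2) for `E/ℚ` (claim binder).
* `thm67_mordellWeilRank_layer_OPEN` — (1.2) = Thm. 6.7 for `A_φ = E` (claim binder).
* `thm66_selmerCorank_layer_OPEN` — Thm. 6.6 "In particular" for `E`, `p ≥ 5` (claim binder).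
* PROVED (kernel; relative to the binders as hypotheses, 0 new facts):
  `exists_rootNumber_neg_of_eqn11_OPEN` (Def. 1.1 "Note that `|Ξ^+_{φ,n}| = |Ξ^−_{φ,n}|` by (1.1)" in its
  existential form: a nontrivial `χ ∈ Ξ` of sign `w` has a Galois-conjugate power `χ^a` of sign `−w`,
  `a` a quadratic non-residue mod `p` — Mathlib `ZMod.exists_sq_eq_neg_one_iff`-free: via
  `legendreSym.eq_neg_one_iff` / existence of a non-square in `ZMod p`);
  `tendsto_mordellWeilRank_layer_of_thm67_OPEN` ("the Mordell–Weil ranks grow systematically": `rank_ℤ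
  E(K^{ac}_n) → ∞`); `shaCorank_layer_eventually_const_of_OPEN` (granted Thm. 6.6 and Thm. 6.7 for `E`:
  the `ℤ_p`-corank of `Ш(E/K^{ac}_n)[p^∞]` is EVENTUALLY CONSTANT, `= 2(c_{6.6} − c_{6.7})`, by the tree's
  discharged identity `corank Sel_{p^∞} = rank + corank Ш[p^∞]`,
  `WeierstrassCurve.selmerCorank_eq_mordellWeilRank_add_holds` — the observation behind §1.2.5 "granting
  the finiteness of the Tate–Shafarevich groups — the very classes producing the Mordell–Weil rank
  growth (1.2)": with `Ш` finite the two constants agree).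

## What is NOT here (typed GAP, reasons)

Thm. 6.7 in its printed generality (`A_φ` a CM abelian variety over `K` attached to a conjugate
symplectic self-dual Hecke character `φ` over a general imaginary quadratic `K`; `dim_{K_φ}`): the tree
has no CM abelian varieties attached to Hecke characters (only elliptic curves) — not typable; Thm. 6.6's
first display (the three `rank_𝒪` terms on `X^{±ε}`): the signed Selmer duals `X^±` are not carriers
(see `SignedSelmerMainIdentity.lean` §"Why an interface"); Thm. 6.1 / Cor. 6.3 (signed control):
same; Lemma 4.4 (1), (3) and Def. 1.2 (Gaussian polynomials): need the local `ε`-factors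
`ε_p(Ind_{K/ℚ}(φξ))` / the partition `Ξ^±` as data — absent; Prop. 6.8 (GZK for `A_{φχ}`): CM abelian
varieties again (for `χ = 1` it is the tree's CM `p`-converse / Gross–Zagier–Kolyvagin–Rubin cluster,
not restated). The E-case of Thm. 6.7 is NOT proved here from Rohrlich + (1.1): the algebraic half
(Weil-restriction decomposition `E(K^{ac}_n) ⊗ ℚ ≅ ⊕_χ A_{φχ}(K) ⊗ ℚ ⊕ …` and Prop. 6.8) has no tree
counterpart. CM by a NON-maximal order (the four `j ∈ cmJInvariants ∖ maximalCMJInvariants`; the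
paper's Thms. 1.5/1.7/1.8 say "CM by an order"): such `E` is `ℚ`-isogenous to a maximal-order curve with
the same CM field and ranks/Selmer coranks are isogeny invariants — not restated (TODO(general form)).

References: [BurungaleKobayashiNakamuraOta2026] arXiv:2608.06879v1 §1.1 (1.1)–(1.2) (p. 3), Def. 1.1
(p. 4), §1.2.4–1.2.5 (pp. 6–7), Def. 4.2 and Lemma 4.4 (p. 26), §6.2 (p. 36), Thm. 6.6 (p. 38), §6.3
Thm. 6.7 and its proof (pp. 38–39) [corpus: paper:arxiv-2608.06879 p0003, p0004, p0006–p0007, p0048,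
p0058, p0060–p0061]; [Rohrlich1984Anticyclotomic] (the input [28] of Thm. 6.7; tree
`RohrlichJia_centralOrder_anticyclotomicTwists`); [SilvermanATAEC1994] II Thms. 9.2/10.5 (the character
`φ`; tree `Deuring_exists_heckeCharacter_of_maximalCM`); [BlochKato1990] Ex. 3.11 (`Sel_f` = classical
Selmer for abelian varieties); [Greenberg1999] §1 (`corank Sel_{p^∞} = rank + corank Ш[p^∞]`).
-/

noncomputable section

open scoped Classical
open Filter WeierstrassCurve NumberField IsDedekindDomain
open Literature.NumberTheory.Automorphic Literature.NumberTheory.GaloisRepresentations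

namespace Literature.NumberTheory.EllipticCurves.BurungaleKobayashiNakamuraOta2026

/-! ## §1 The three printed statements, for `E/ℚ` (claim binders; nothing asserted) -/

/-- **[BKNO] (1.1) = Lemma 4.4 (2): the root numbers of the anticyclotomic twists equidistribute within
every layer** — "`ε(φχ^a) = (a/p) ε(φχ)`, where `φ` is the Hecke character over `K` associated to `E`,
`χ` an anticyclotomic character of order `p^n > 1` and `a` an integer prime to `p`" (§1.1 p. 3); Lemma
4.4 (2) (p. 26): "For `b ∈ ℤ_p^×` and a nontrivial finite order character `χ` of `Γ`, we have
`ε(φχ^b) = (b/p) ε(φχ)`." Transcription (module docstring): `E/ℚ` elliptic with CM by `𝒪_K`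
(`W.j ∈ maximalCMJInvariants`), `K` its CM field (`IsCMFieldOfJ K W.j`) with complex conjugation
`c ≠ 1`; `φ` a Hecke character of `K` of infinity type `(1,0)`, conj-equivariant, with `L(E/ℚ,s) =
L(s,φ)` on `re s > 3/2` (the clauses of Deuring's theorem pinning "the Hecke character associated to
`E`"); `p` an odd prime with `p ∣ d_K = cmFieldDiscr W.j`; `κ` the (an) anticyclotomic `ℤ_p`-extension
of `K`; `χ` a finite-order character of `Γ^{ac} = Gal(K^{ac}_∞/K)` of level `≤ n` (`IsAcCharacter ι κ n χ
r`, `r` its `p`-adic avatar) with `χ ≠ 1`; `a : ℕ` with `p ∤ a`; `ε(·)` = the sign of the functional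
equation in the weight-two normalisation (`IsCentralRootNumber`), `(a/p)` = `legendreSym p a`.
Conclusion: `W(φχ) = w ⟹ W(φχ^a) = (a/p)·w`. PREPRINT; the printed proof refers to the authors'
prequel [5, Prop. 8.2] (arXiv:2508.17776, preprint). Nothing asserted.
[claim: BurungaleKobayashiNakamuraOta2026, status: under-review] -/
def eqn11_rootNumber_pow_OPEN : Prop :=
  ∀ (W : WeierstrassCurve ℚ) [W.IsElliptic], W.j ∈ maximalCMJInvariants →
    ∀ (K : Type) [Field K] [NumberField K], IsCMFieldOfJ K W.j → ∀ (c : K ≃ₐ[ℚ] K), c ≠ 1 →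
      ∀ (φ : HeckeCharacter K), φ.HasInfinityType (fun _ ↦ 1) (fun _ ↦ 0) →
        IsHeckeConjEquivariant c φ → (∀ s : ℂ, 3 / 2 < s.re → heckeLFunction φ s = W.LSeries s) →
      ∀ (p : ℕ) [Fact p.Prime], p ≠ 2 → (p : ℤ) ∣ cmFieldDiscr W.j →
        ∀ (κ : ZpExtension K p), κ.IsAnticyclotomic →
        ∀ (ι : PadicAlgCl p ≃+* ℂ) (n : ℕ) (χ : HeckeCharacter K)
          (r : FramedGaloisRep K (PadicAlgCl p) 1), IsAcCharacter ι κ n χ r → χ ≠ 1 →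
          ∀ (a : ℕ), ¬ p ∣ a → ∀ (w : ℂ), IsCentralRootNumber (φ * χ) w →
            IsCentralRootNumber (φ * χ ^ a) ((legendreSym p a : ℂ) * w)

/-- **[BKNO] (1.2) = Theorem 6.7 for `A_φ = E`: the Mordell–Weil rank over the anticyclotomic layers
grows like `(p^n − 1)/2`** — §1.1 (p. 3): "Let `E/ℚ` be an elliptic curve with CM by the ring of integers
`𝒪_K` of an imaginary quadratic field `K`, let `p` be an odd prime ramified in `K`, and let `K^{ac}_∞` be
the anticyclotomic `ℤ_p`-extension of `K` with `n`-th layer `K^{ac}_n`. […] for `n ≫ 0`,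
`rank_{𝒪_K} E(K^{ac}_n) = (p^n − 1)/2 + c` (1.2) for a constant `c` (cf. Theorem 6.7)"; Thm. 6.7 (p. 38):
"There exists a constant `c ∈ ℤ` such that for any sufficiently large integer `n`, we have
`dim_{K_φ}(A_φ(K^{ac}_n) ⊗_ℤ ℚ) = (p^n − 1)/2 + c`" (for `E/ℚ` with CM by `𝒪_K`: `A_φ = E_K`, `K_φ = K`).
Transcription: the frame of `eqn11_rootNumber_pow_OPEN`; `rank_{𝒪_K} = ½ rank_ℤ`, so in the tree's
`ℤ`-rank currency (`WeierstrassCurve.mordellWeilRank` of the base change to the layer field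
`κ.layer n`, cast to `ℤ`): `∃ c ∈ ℤ, ∀ᶠ n, rank_ℤ E(K^{ac}_n) = p^n − 1 + 2c` — (1.2) doubled, nothing
more. PREPRINT (proof: Weil restriction + Rohrlich [Rohrlich1984Anticyclotomic] + Lemma 4.4 + Gross–
Zagier–Kolyvagin for the CM abelian varieties `A_{φχ}`, Prop. 6.8). Nothing asserted.
[claim: BurungaleKobayashiNakamuraOta2026, status: under-review] -/
def thm67_mordellWeilRank_layer_OPEN : Prop :=
  ∀ (W : WeierstrassCurve ℚ) [W.IsElliptic], W.j ∈ maximalCMJInvariants →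
    ∀ (K : Type) [Field K] [NumberField K], IsCMFieldOfJ K W.j →
      ∀ (p : ℕ) [Fact p.Prime], p ≠ 2 → (p : ℤ) ∣ cmFieldDiscr W.j →
        ∀ (κ : ZpExtension K p), κ.IsAnticyclotomic →
          ∃ c : ℤ, ∀ᶠ n : ℕ in atTop,
            ((W.baseChange (κ.layer n)).mordellWeilRank : ℤ) = (p : ℤ) ^ n - 1 + 2 * c

/-- **[BKNO] Theorem 6.6, "In particular": the `p^∞`-Selmer corank over the anticyclotomic layers is
`(p^n − 1)/2 + c`, `c ≥ 0`, for `n ≫ 1`** (p. 38; §6.2: `p` ramified in `K`): "In particular, there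
exists an integer `c ≥ 0` such that for `n ≫ 1` we have `corank_𝒪(Sel(K^{ac}_n, W)) = (p^n − 1)/2 + c`."
Transcription (module docstring, the dictionary): for `E/ℚ` with CM by `𝒪_K` the divisible module
`W = W(E)` of §3 is `E[p^∞] ⊗_{𝒪_𝔭} 𝒪`, `Sel = Sel_f` (Bloch–Kato) is the classical `p^∞`-Selmer group
[BlochKato1990, Ex. 3.11], and `corank_𝒪 = ½ corank_{ℤ_p}`; so in the tree's currency
(`WeierstrassCurve.selmerCorank` of the base change to `κ.layer n`, cast to `ℤ`): `∃ c ∈ ℕ, ∀ᶠ n,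
corank_{ℤ_p} Sel_{p^∞}(E/K^{ac}_n) = p^n − 1 + 2c` — the printed display doubled. SCOPE `p ≥ 5` (the
intro's standing hypothesis §1.2.1; at `p = 3`, `K = ℚ(√−3)` the printed proof goes through Cor. 6.3 ⇐
Thm. 6.1, stated under Assumption 3.1 (1) — see Remark 6.2; not typed there). PREPRINT. Nothing
asserted. [claim: BurungaleKobayashiNakamuraOta2026, status: under-review] -/
def thm66_selmerCorank_layer_OPEN : Prop :=
  ∀ (W : WeierstrassCurve ℚ) [W.IsElliptic], W.j ∈ maximalCMJInvariants →
    ∀ (K : Type) [Field K] [NumberField K], IsCMFieldOfJ K W.j →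
      ∀ (p : ℕ) [Fact p.Prime], 5 ≤ p → (p : ℤ) ∣ cmFieldDiscr W.j →
        ∀ (κ : ZpExtension K p), κ.IsAnticyclotomic →
          ∃ c : ℕ, ∀ᶠ n : ℕ in atTop,
            ((W.baseChange (κ.layer n)).selmerCorank p : ℤ) = (p : ℤ) ^ n - 1 + 2 * c

/-! ## §2 Proved corollaries (kernel; the binders enter as hypotheses; 0 new facts) -/

/-- **Def. 1.1: "Note that `|Ξ^+_{φ,n}| = |Ξ^−_{φ,n}|` by (1.1)" — existential form.** Granted (1.1)
(`eqn11_rootNumber_pow_OPEN`, hypothesis `h11`): if a nontrivial `χ ∈ Ξ` of level `≤ n` has root number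
`W(φχ) = w`, then for any quadratic NON-residue `a` mod `p` (one exists since `p` is odd: Mathlib
`ZMod.exists_nonsquare`-style, here via `legendreSym.eq_neg_one_iff`), `W(φχ^a) = −w`; so both signs
occur among the Galois conjugates `{χ^a}` of every nontrivial `χ`. PROVED from the binder.
[claim: BurungaleKobayashiNakamuraOta2026, status: under-review] -/
theorem exists_rootNumber_neg_of_eqn11_OPEN (h11 : eqn11_rootNumber_pow_OPEN)
    (W : WeierstrassCurve ℚ) [W.IsElliptic] (hj : W.j ∈ maximalCMJInvariants)
    (K : Type) [Field K] [NumberField K] (hK : IsCMFieldOfJ K W.j) (c : K ≃ₐ[ℚ] K) (hc : c ≠ 1)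
    (φ : HeckeCharacter K) (hφ : φ.HasInfinityType (fun _ ↦ 1) (fun _ ↦ 0))
    (heq : IsHeckeConjEquivariant c φ) (hL : ∀ s : ℂ, 3 / 2 < s.re → heckeLFunction φ s = W.LSeries s)
    (p : ℕ) [Fact p.Prime] (hp : p ≠ 2) (hram : (p : ℤ) ∣ cmFieldDiscr W.j)
    (κ : ZpExtension K p) (hκ : κ.IsAnticyclotomic) (ι : PadicAlgCl p ≃+* ℂ) (n : ℕ)
    (χ : HeckeCharacter K) (r : FramedGaloisRep K (PadicAlgCl p) 1) (hχ : IsAcCharacter ι κ n χ r)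
    (hne : χ ≠ 1) (w : ℂ) (hw : IsCentralRootNumber (φ * χ) w) :
    ∃ a : ℕ, ¬ p ∣ a ∧ IsCentralRootNumber (φ * χ ^ a) (-w) := by
  -- a quadratic non-residue mod the odd prime `p` (`FiniteField.exists_nonsquare`)
  obtain ⟨x, hx⟩ := FiniteField.exists_nonsquare (F := ZMod p)
    (by rw [ZMod.ringChar_zmod_n]; exact hp)
  have hxval : ((x.val : ℕ) : ZMod p) = x := ZMod.natCast_zmod_val x
  have hndvd : ¬ p ∣ x.val := by
    intro hdvd
    apply hx
    rw [← hxval, (ZMod.natCast_eq_zero_iff x.val p).mpr hdvd]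
    exact IsSquare.zero
  have hleg : legendreSym p (x.val : ℤ) = -1 := by
    rw [legendreSym.eq_neg_one_iff, Int.cast_natCast, hxval]
    exact hx
  refine ⟨x.val, hndvd, ?_⟩
  have h := h11 W hj K hK c hc φ hφ heq hL p hp hram κ hκ ι n χ r hχ hne x.val hndvd w hw
  rw [hleg] at h
  simpa using h

/-- **"Accordingly the Mordell–Weil ranks grow systematically" (§1.1): granted (1.2)/Thm. 6.7 for `E`
(`thm67_mordellWeilRank_layer_OPEN`, hypothesis `h67`), `rank_ℤ E(K^{ac}_n) → ∞`.** PROVED from the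
binder (`p^n → ∞`). [claim: BurungaleKobayashiNakamuraOta2026, status: under-review] -/
theorem tendsto_mordellWeilRank_layer_of_thm67_OPEN (h67 : thm67_mordellWeilRank_layer_OPEN)
    (W : WeierstrassCurve ℚ) [W.IsElliptic] (hj : W.j ∈ maximalCMJInvariants)
    (K : Type) [Field K] [NumberField K] (hK : IsCMFieldOfJ K W.j)
    (p : ℕ) [Fact p.Prime] (hp : p ≠ 2) (hram : (p : ℤ) ∣ cmFieldDiscr W.j)
    (κ : ZpExtension K p) (hκ : κ.IsAnticyclotomic) :
    Tendsto (fun n : ℕ ↦ ((W.baseChange (κ.layer n)).mordellWeilRank : ℤ)) atTop atTop := by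
  obtain ⟨c, hc⟩ := h67 W hj K hK p hp hram κ hκ
  have hp1 : 1 < (p : ℤ) := by exact_mod_cast (Fact.out : p.Prime).one_lt
  have hpow : Tendsto (fun n : ℕ ↦ (p : ℤ) ^ n - 1 + 2 * c) atTop atTop := by
    have h1 : Tendsto (fun n : ℕ ↦ (p : ℤ) ^ n) atTop atTop :=
      tendsto_pow_atTop_atTop_of_one_lt hp1
    have h2 : Tendsto (fun n : ℕ ↦ (p : ℤ) ^ n + (2 * c - 1)) atTop atTop :=
      tendsto_atTop_add_const_right _ _ h1
    refine h2.congr ?_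
    intro n
    ring
  exact hpow.congr' (hc.mono fun n hn ↦ hn.symm)

/-- **Granted Thm. 6.6 and Thm. 6.7 for `E`, the `ℤ_p`-corank of `Ш(E/K^{ac}_n)[p^∞]` is eventually
constant along the anticyclotomic tower** (`= 2(c_{6.6} − c_{6.7})`): by the tree's discharged identity
`corank_{ℤ_p} Sel_{p^∞}(E/F) = rank_ℤ E(F) + corank_{ℤ_p} Ш(E/F)[p^∞]`
(`WeierstrassCurve.selmerCorank_eq_mordellWeilRank_add_holds`, [Greenberg1999] §1) over each layer
`F = K^{ac}_n`, the two growth laws `p^n − 1 + 2c` and `p^n − 1 + 2c′` differ by the eventually constant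
`corank Ш[p^∞]`. This is the bookkeeping behind §1.2.5 ("granting the finiteness of the
Tate–Shafarevich groups — the very classes producing the Mordell–Weil rank growth (1.2)"): with
`Ш(E/K^{ac}_n)[p^∞]` finite for `n ≫ 0` the constants of Thm. 6.6 (doubled) and (1.2) (doubled) agree.
PROVED from the two binders (hypotheses `h66`, `h67`); scope `p ≥ 5` (that of `h66`).
[claim: BurungaleKobayashiNakamuraOta2026, status: under-review] [cite: Greenberg1999, §1 (corank identity)] -/
theorem shaCorank_layer_eventually_const_of_OPEN (h66 : thm66_selmerCorank_layer_OPEN)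
    (h67 : thm67_mordellWeilRank_layer_OPEN)
    (W : WeierstrassCurve ℚ) [W.IsElliptic] (hj : W.j ∈ maximalCMJInvariants)
    (K : Type) [Field K] [NumberField K] (hK : IsCMFieldOfJ K W.j)
    (p : ℕ) [Fact p.Prime] (hp : 5 ≤ p) (hram : (p : ℤ) ∣ cmFieldDiscr W.j)
    (κ : ZpExtension K p) (hκ : κ.IsAnticyclotomic) :
    ∃ (c : ℕ) (c' : ℤ) (d : ℕ), (d : ℤ) = 2 * (c : ℤ) - 2 * c' ∧
      (∀ᶠ n : ℕ in atTop, ((W.baseChange (κ.layer n)).selmerCorank p : ℤ) = (p : ℤ) ^ n - 1 + 2 * c) ∧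
      (∀ᶠ n : ℕ in atTop,
        ((W.baseChange (κ.layer n)).mordellWeilRank : ℤ) = (p : ℤ) ^ n - 1 + 2 * c') ∧
      ∀ᶠ n : ℕ in atTop, (W.baseChange (κ.layer n)).shaCorank p = d := by
  have hp2 : p ≠ 2 := by omega
  obtain ⟨c, hc⟩ := h66 W hj K hK p hp hram κ hκ
  obtain ⟨c', hc'⟩ := h67 W hj K hK p hp2 hram κ hκ
  -- the corank identity over each layer
  have hid : ∀ n : ℕ, ((W.baseChange (κ.layer n)).selmerCorank p : ℤ) =
      ((W.baseChange (κ.layer n)).mordellWeilRank : ℤ) + ((W.baseChange (κ.layer n)).shaCorank p : ℤ) :=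
    fun n ↦ by exact_mod_cast (W.baseChange (κ.layer n)).selmerCorank_eq_mordellWeilRank_add_holds p
  -- eventually `sha_n = 2c − 2c'` as integers
  have hsha : ∀ᶠ n : ℕ in atTop,
      ((W.baseChange (κ.layer n)).shaCorank p : ℤ) = 2 * (c : ℤ) - 2 * c' := by
    filter_upwards [hc, hc'] with n hn hn'
    have := hid n
    linarith
  -- the constant is a natural number (coranks are `≥ 0`)
  obtain ⟨n₀, hn₀⟩ := hsha.exists
  have hnonneg : (0 : ℤ) ≤ 2 * (c : ℤ) - 2 * c' := by rw [← hn₀]; positivity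
  refine ⟨c, c', (2 * (c : ℤ) - 2 * c').toNat, (Int.toNat_of_nonneg hnonneg), hc, hc', ?_⟩
  filter_upwards [hsha] with n hn
  have h := Int.toNat_of_nonneg hnonneg
  omega

end Literature.NumberTheory.EllipticCurves.BurungaleKobayashiNakamuraOta2026
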